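import Mathlib.Probability.Distributions.Gaussian.Real
import Mathlib.MeasureTheory.Integral.Gamma
import Mathlib.Analysis.SpecialFunctions.Gaussian.GaussianIntegral
import HarnessLib

/-!
# Moments of the real Gaussian (topic `Probability/Distributions`)

The classical moment formulas of the centred Gaussian `𝒩(0, v)` on `ℝ` (Mathlib's
`ProbabilityTheory.gaussianReal 0 v`):

* `integral_pow_odd_gaussianReal` — odd moments vanish, `𝔼[X^{2r+1}] = 0`;
* `integral_pow_even_gaussianReal_one` — `𝔼[X^{2r}] = (2r − 1)‼` for the standard Gaussian;
* `integral_pow_even_gaussianReal` — `𝔼[X^{2r}] = v^r (2r − 1)‼` in general.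

(Janson, *Gaussian Hilbert Spaces* (1997), Remark 1.30: "if `ξ ∼ N(0, σ²)`, then
`E ξⁿ = (n−1)!! σⁿ` for `n` even, `0` for `n` odd"; historically Isserlis 1918). The proof is
the standard computation through `Γ(r + 1/2) = (2r−1)‼ √π / 2^r` (Mathlib's
`Real.Gamma_nat_add_half`) and `∫₀^∞ x^q e^{-b x²} dx` (Mathlib's
`integral_rpow_mul_exp_neg_mul_rpow`). Mathlib has the Gaussian's mean, variance, moment
generating function (`mgf_id_gaussianReal`) and all `Lᵖ` memberships (`memLp_id_gaussianReal`),
but not the closed form of the moments (searched `doubleFactorial`/`‼` under `Probability/`).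
These are the one-dimensional input of Wick's formula for mixed moments of jointly Gaussian
variables (Janson 1997, Thm. 1.28), needed e.g. for Raz–Tal 2022, Claim 4.1.

## References

* S. Janson, *Gaussian Hilbert Spaces*, Cambridge Tracts in Math. 129 (1997), Thm. 1.28,
  Remarks 1.29–1.30.
* L. Isserlis, *On a formula for the product-moment coefficient of any order of a normal
  frequency distribution in any number of variables*, Biometrika 12 (1918), 134–139.
-/

namespace Literature.Probability.Distributions

open MeasureTheory ProbabilityTheory Real Set
open scoped Nat NNReal

/-- Powers are integrable against the Gaussian (all moments are finite; from Mathlib's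
`memLp_id_gaussianReal`). [folklore] -/
theorem integrable_pow_gaussianReal (μ : ℝ) (v : ℝ≥0) (k : ℕ) :
    Integrable (fun x : ℝ => x ^ k) (gaussianReal μ v) := by
  have h := (memLp_id_gaussianReal (μ := μ) (v := v) (k : ℝ≥0)).integrable_norm_pow'
  exact h.mono' (by fun_prop) (ae_of_all _ fun x => by simp)

/-- **Odd moments of a centred Gaussian vanish**: `∫ x^{2r+1} d𝒩(0,v) = 0` (symmetry
`x ↦ −x`, Mathlib's `gaussianReal_map_neg`; Janson 1997, Rem. 1.30, odd case). [cite: Janson1997, Rem. 1.30] -/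
theorem integral_pow_odd_gaussianReal (v : ℝ≥0) (r : ℕ) :
    ∫ x, x ^ (2 * r + 1) ∂(gaussianReal 0 v) = 0 := by
  have hneg : (gaussianReal 0 v).map (fun x => -x) = gaussianReal 0 v := by
    rw [gaussianReal_map_neg, neg_zero]
  have h1 : ∫ x, x ^ (2 * r + 1) ∂(gaussianReal 0 v) =
      ∫ x, (-x) ^ (2 * r + 1) ∂(gaussianReal 0 v) := by
    conv_lhs => rw [← hneg]
    rw [integral_map measurable_neg.aemeasurable (by fun_prop)]
  have h2 : ∫ x, (-x) ^ (2 * r + 1) ∂(gaussianReal 0 v) = -∫ x, x ^ (2 * r + 1) ∂(gaussianReal 0 v) := by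
    rw [← integral_neg]
    refine integral_congr_ae (ae_of_all _ fun x => ?_)
    show (-x) ^ (2 * r + 1) = -x ^ (2 * r + 1)
    exact Odd.neg_pow ⟨r, rfl⟩ x
  linarith

/-- The Gaussian integral behind the even moments:
`∫_ℝ x^{2r} e^{-x²/2} dx = √(2π) (2r−1)‼` (via `Γ(r + 1/2)`). [cite: Janson1997, Rem. 1.30] -/
theorem integral_pow_even_mul_exp_neg_sq_half (r : ℕ) :
    ∫ x : ℝ, x ^ (2 * r) * rexp (-x ^ 2 / 2) = √(2 * π) * ((2 * r - 1 : ℕ)‼ : ℝ) := by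
  -- reduce to the half-line by evenness
  have heven : ∫ x : ℝ, x ^ (2 * r) * rexp (-x ^ 2 / 2) =
      ∫ x : ℝ, |x| ^ (2 * r) * rexp (-|x| ^ 2 / 2) := by
    refine integral_congr_ae (ae_of_all _ fun x => ?_)
    simp only [pow_mul, sq_abs]
  have hcomp := integral_comp_abs (f := fun y : ℝ => y ^ (2 * r) * rexp (-y ^ 2 / 2))
  rw [heven, hcomp]
  -- the half-line integral through the Gamma function
  have key := integral_rpow_mul_exp_neg_mul_rpow (p := 2) (q := (2 * r : ℕ)) (b := 1 / 2)
    (by norm_num) (by have h0 : (0 : ℝ) ≤ ((2 * r : ℕ) : ℝ) := Nat.cast_nonneg _; linarith) (by norm_num)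
  have hcongr : ∫ x in Ioi (0 : ℝ), x ^ (2 * r) * rexp (-x ^ 2 / 2) =
      ∫ x in Ioi (0 : ℝ), x ^ ((2 * r : ℕ) : ℝ) * rexp (-(1 / 2) * x ^ (2 : ℝ)) := by
    refine setIntegral_congr_fun measurableSet_Ioi fun x hx => ?_
    rw [rpow_natCast, rpow_two]
    ring_nf
  rw [hcongr, key]
  -- simplify `(1/2)^{-(2r+1)/2} · (1/2) · Γ(r + 1/2)`
  have hG : Gamma (((2 * r : ℕ) + 1) / 2) = ((2 * r - 1 : ℕ)‼ : ℝ) * √π / 2 ^ r := by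
    rw [show (((2 * r : ℕ) : ℝ) + 1) / 2 = (r : ℝ) + 1 / 2 by push_cast; ring]
    exact Real.Gamma_nat_add_half r
  rw [hG]
  have hpow : (1 / 2 : ℝ) ^ (-(((2 * r : ℕ) : ℝ) + 1) / 2) = 2 ^ ((r : ℝ) + 1 / 2) := by
    rw [one_div, inv_rpow (by norm_num : (0 : ℝ) ≤ 2), ← rpow_neg (by norm_num : (0 : ℝ) ≤ 2)]
    congr 1
    push_cast
    ring
  rw [hpow, rpow_add (by norm_num : (0 : ℝ) < 2), rpow_natCast,
    show (2 : ℝ) ^ (1 / 2 : ℝ) = √2 by rw [sqrt_eq_rpow]]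
  have hsq : √(2 * π) = √2 * √π := sqrt_mul (by norm_num) π
  rw [hsq]
  have h2r : (2 : ℝ) ^ r ≠ 0 := by positivity
  field_simp

/-- **Even moments of the standard Gaussian**: `∫ x^{2r} d𝒩(0,1) = (2r − 1)‼`
(Janson 1997, Rem. 1.30 with `σ = 1`; Isserlis 1918). [cite: Janson1997, Rem. 1.30] [cite: Isserlis1918] -/
theorem integral_pow_even_gaussianReal_one (r : ℕ) :
    ∫ x, x ^ (2 * r) ∂(gaussianReal 0 1) = ((2 * r - 1 : ℕ)‼ : ℝ) := by
  rw [integral_gaussianReal_eq_integral_smul one_ne_zero]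
  simp only [gaussianPDFReal_def, smul_eq_mul, NNReal.coe_one, mul_one, sub_zero]
  have h : ∀ x : ℝ, (√(2 * π))⁻¹ * rexp (-x ^ 2 / 2) * x ^ (2 * r) =
      (√(2 * π))⁻¹ * (x ^ (2 * r) * rexp (-x ^ 2 / 2)) := fun x => by ring
  have h' : (fun x : ℝ => (√(2 * π * 1))⁻¹ * rexp (-(x - 0) ^ 2 / (2 * 1)) * x ^ (2 * r)) =
      fun x => (√(2 * π))⁻¹ * (x ^ (2 * r) * rexp (-x ^ 2 / 2)) := by
    funext x; rw [← h x]; simp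
  simp only [mul_one, sub_zero] at h' ⊢
  rw [show (fun x : ℝ => (√(2 * π))⁻¹ * rexp (-x ^ 2 / 2) * x ^ (2 * r)) =
      fun x => (√(2 * π))⁻¹ * (x ^ (2 * r) * rexp (-x ^ 2 / 2)) from funext h,
    integral_const_mul, integral_pow_even_mul_exp_neg_sq_half]
  have : √(2 * π) ≠ 0 := by positivity
  field_simp

/-- **Even moments of a centred Gaussian**: `∫ x^{2r} d𝒩(0,v) = v^r (2r − 1)‼` (scaling
`X = √v · Z`, Mathlib's `gaussianReal_map_const_mul`; Janson 1997, Rem. 1.30: `E ξⁿ = (n−1)!! σⁿ`,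
`σ² = v`). [cite: Janson1997, Rem. 1.30] -/
theorem integral_pow_even_gaussianReal (v : ℝ≥0) (r : ℕ) :
    ∫ x, x ^ (2 * r) ∂(gaussianReal 0 v) = (v : ℝ) ^ r * ((2 * r - 1 : ℕ)‼ : ℝ) := by
  -- `𝒩(0,v)` is the image of `𝒩(0,1)` under `x ↦ √v · x`
  have hmap : (gaussianReal 0 1).map (fun x => √(v : ℝ) * x) = gaussianReal 0 v := by
    rw [gaussianReal_map_const_mul]
    congr 1
    · simp
    · ext
      push_cast
      rw [mul_one, sq_sqrt v.coe_nonneg]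
  rw [← hmap, integral_map (by fun_prop) (by fun_prop)]
  simp only [mul_pow]
  rw [integral_const_mul, integral_pow_even_gaussianReal_one, pow_mul, sq_sqrt v.coe_nonneg]

end Literature.Probability.Distributions
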